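import Literature.NumberTheory.Automorphic.OrbitalIntegralFixedPointCount   -- ★ λ = 0 model: `mem_preimage_mul_out_iff`, `pairwiseDisjoint_preimage_mul_out`; brings ★ `InvariantQuotientCompactSubgroup` (`quotientMeasure`, `lintegral_quotientMeasure_eq_inv_mul`)
import Literature.NumberTheory.Rogawski1990.Ch4Sec10Bridge                    -- ★ `mem_epsCentralizer_iff` (brings ★ `Ch4Sec10`: `epsCentralizer`, `descEpsConj`, `epsOrbitalIntegral`)
import Mathlib.Data.Real.ENatENNReal
import HarnessLib

/-!
# R90 · S6 «Ch. 14.1–14.5 stable trace formula» — card J1′ (row E1.4.4.2.1 «TWISTED UNFOLDING BRICK»): THE ε-TWISTED ORBITAL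
# INTEGRAL OF THE INDICATOR OF A TWISTED-`K`-INVARIANT OPEN SET AT A COMPACT ε-CENTRALISER IS `ν(K)` TIMES THE NUMBER OF COSETS
# `yK` WITH `y⁻¹ δ ε(y) ∈ S` (`Theorems/R90S6TwistedOrbitalIndicatorCount.lean`)

The ε-twisted twin of ★ (J1) `Theorems/R90S6OrbitalIndicatorShellCount.lean` (R90-C14-p03 (g2), `O_γ(1_S) = ν(K) · #{yK : y⁻¹γy ∈ S}`),
in the tree's generic twisted currency ★ `Literature.NumberTheory.Rogawski1990.Ch4Sec10` (the currency S6-D's conjunct 2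
`StubR90ExtE1TwistedTransferFL` and the S4 ε-files quantify over): a group `G` with an endomorphism `ε : G →* G`, the ε-centraliser
`G_{δε} = epsCentralizer ε δ = {g : g δ ε(g)⁻¹ = δ}`, the descended twisted integrand `descEpsConj ε δ G_{δε} φ : G ⧸ G_{δε} → α`,
`y G_{δε} ↦ φ(y δ ε(y)⁻¹)`, and the twisted orbital integral `Φ_ε(δ, φ; m) = epsOrbitalIntegral ε δ φ m = ∫_{G ⧸ G_{δε}} φ(y δ ε(y)⁻¹) dm`
([Rogawski1990] §1.6, §4.10 (4.10.1); [Kottwitz1986BaseChangeUnits] §1 «`TO_δ(f) = ∫_{G_{δσ}\G(L)} f(g⁻¹ δ σ(g))`»).  For `K ≤ G` an open subgroup, `ν` a Haar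
measure on `G`, `S ⊆ G` open and invariant under TWISTED `K`-conjugation `x ↦ k x ε(k)⁻¹` (`hSK`; e.g. any bi-`K`-invariant `S` — a Hecke shell
`K t K` — as soon as `ε(K) ⊆ K`, §0), and `δ` with COMPACT ε-centraliser carrying a Haar measure `t` of total mass one:

  **`Φ_ε(δ, 1_S; ν∕t) = ν(K) · #{q ∈ G ⧸ K : q.out⁻¹ δ ε(q.out) ∈ S}`**

— the number of cosets `yK` whose «twisted relative position» `y⁻¹ δ ε(y)` lies in the shell `S` (well defined by `hSK`,
`inv_mul_mul_apply_mem_iff_out`).  ROAD = (J1)'s, verbatim with `y ↦ y δ ε(y)⁻¹` for `y ↦ y γ y⁻¹`: the set `{g : g δ ε(g)⁻¹ ∈ S}` is the disjoint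
union over these `q` of the right cosets `K · q.out⁻¹` (the fibres of `g ↦ g⁻¹K`, ★ `mem_preimage_mul_out_iff`), each of measure `ν(K)` (§1, in `[0, ∞]`
with `Set.encard`, no finiteness); the quotient measure by the compact `G_{δε}` is `t(G_{δε})⁻¹ · π_*ν` (★ `lintegral_quotientMeasure_eq_inv_mul`) and the
twisted integrand of `1_S` lifts to `1_{{g δ ε(g)⁻¹ ∈ S}}` (§2, `descEpsConj` being read on cosets through `measurable_descEpsConj` — continuity of `ε`
is the one new hypothesis); the real twisted orbital integral follows for finitely many such `q` (§3).  With `ε = 1` (`MonoidHom.id`) every statement is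
(J1)'s, up to the spelling `epsCentralizer (MonoidHom.id G) γ` of the centraliser.
CONSUMER DRESS (not here; E1.4.4.2.3 ∕ E1.4.4.5a): `G := GtLoc L v`, `ε := epsLoc L Φ v` (★ `continuous_epsLoc`), `K :=` the hyperspecial `K̃_v`, `t` pinned by
★ `IsEpsCanonicalAt` and read at any class member by ★ `R90.S4.IsEpsCanonicalAt.classEpsOrbitalIntegral_eq_epsOrbitalIntegral` (elliptic `δ`: compact core =
`G_{δε}`, so `t univ = 1`).

Cell `hodgecm-mathlib`, crux H413 (`stmt-HodgeConjecture-24833`), route of record `HCCMUnconditional`; programme R90-TF, section S6 (base `R90-C14`,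
dealer R90-C14-plan (g2), card J1′ 2026-09-05T00:10:44Z), seat R90-C14-p08 (g0).  Lane `--kind proof --supports stmt-HodgeConjecture-24833 --as helper`;
THEOREMS ONLY over ★ Literature carriers (no definition, no instance, no notation, no named fact, no kit, no `sorry`); generic topological-group layer,
no S4 ∕ CM import.
HONEST LABEL: measure bookkeeping, count-neutral until the E1.4.4.2.3 ∕ E1.4.4.5a assemblies consume it; proves no printed global statement, discharges
no citation; HC_CM is proved only modulo the 7 printed citations (2 remaining named inputs: hLiu418 = stmt-HodgeConjecture-24832,
h413 = stmt-HodgeConjecture-24833) until rung 0 closes.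

## References
* [Rogawski1990] J. D. Rogawski, *Automorphic Representations of Unitary Groups in Three Variables*, Ann. of Math. Stud. 123 (1990): §1.6 pp. 5–6
  (twisted orbital integrals), §4.9 p. 54 («`Φ(γ, f) = Σ_{x ∈ G_γ\G/K} vol(G_γ ∩ xKx⁻¹)⁻¹ f(x⁻¹γx)`»), §4.10 (4.10.1) p. 57.
* [Kottwitz1986BaseChangeUnits] R. E. Kottwitz, *Base change for unit elements of Hecke algebras*, Compositio Math. 60 (1986): §1 pp. 239–240
  (`TO_δ(1_{K_L})` as a count of `σ`-twisted fixed cosets), §3.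
* [Laumon1995] G. Laumon, *Cohomology of Drinfeld Modular Varieties*, Part I (1996): Lemma (5.3.2) p. 136 (the fibre count).
-/

set_option autoImplicit false
-- the mandated namespace repeats the single-problem summit's segment (`HodgeConjecture.HodgeConjecture`)
set_option linter.dupNamespace false

noncomputable section

open MeasureTheory Measure Topology Set Filter Function
open Literature.MeasureTheory.Group Literature.NumberTheory.Automorphic
open Literature.NumberTheory.Rogawski1990.Ch4Sec10
open scoped ENNReal NNReal Pointwise

namespace Summit.HodgeConjecture.HodgeConjecture.R90.S6

/-! ## §0 Feed: a bi-`K`-invariant set is invariant under twisted `K`-conjugation as soon as `ε(K) ⊆ K` -/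

section Feed

variable {G : Type*} [Group G] (ε : G →* G) (K : Subgroup G) {S : Set G}

/-- **Hecke shells qualify**: if `ε(K) ⊆ K` and `S` is bi-`K`-invariant (`x g y ∈ S ↔ g ∈ S` for `x, y ∈ K` — e.g. a double coset `K t K`, the
support of a Hecke basis element), then `S` is invariant under the twisted `K`-conjugation `g ↦ k g ε(k)⁻¹`.
[cite: Kottwitz1986BaseChangeUnits, §1 p. 239] -/
theorem twistedConj_mem_iff_of_biInvariant (hεK : ∀ k : G, k ∈ K → ε k ∈ K)
    (hS : ∀ x : G, x ∈ K → ∀ y : G, y ∈ K → ∀ g : G, x * g * y ∈ S ↔ g ∈ S) :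
    ∀ k : G, k ∈ K → ∀ g : G, k * g * (ε k)⁻¹ ∈ S ↔ g ∈ S :=
  fun k hk g => hS k hk (ε k)⁻¹ (K.inv_mem (hεK k hk)) g

end Feed

/-! ## §1 `ν{g : g δ ε(g)⁻¹ ∈ S} = ν(K) · #{q ∈ G ⧸ K : q.out⁻¹ δ ε(q.out) ∈ S}` -/

section Shell

variable {G : Type*} [Group G] (ε : G →* G) (δ : G) (K : Subgroup G) {S : Set G}
  (hSK : ∀ k : G, k ∈ K → ∀ g : G, k * g * (ε k)⁻¹ ∈ S ↔ g ∈ S)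
include hSK

/-- **The twisted shell condition is well defined on `G ⧸ K`**: for `S` invariant under twisted `K`-conjugation,
`g⁻¹ δ ε(g) ∈ S ↔ q.out⁻¹ δ ε(q.out) ∈ S` for the chosen representative `q.out = g k` (`k ∈ K`) of `q = gK`.
[cite: Kottwitz1986BaseChangeUnits, §1 p. 240] [cite: Rogawski1990, §4.9 p. 54] -/
theorem inv_mul_mul_apply_mem_iff_out (g : G) :
    g⁻¹ * δ * ε g ∈ S ↔ ((g : G ⧸ K)).out⁻¹ * δ * ε ((g : G ⧸ K)).out ∈ S := by
  obtain ⟨k, hk⟩ := QuotientGroup.mk_out_eq_mul K g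
  rw [hk, mul_inv_rev, map_mul,
    show (k : G)⁻¹ * g⁻¹ * δ * (ε g * ε (k : G)) = (k : G)⁻¹ * (g⁻¹ * δ * ε g) * (ε ((k : G)⁻¹))⁻¹ by
      rw [map_inv, inv_inv]; group]
  exact (hSK _ (K.inv_mem k.2) _).symm

/-- **`{g : g δ ε(g)⁻¹ ∈ S}` is the disjoint union, over the cosets `q = yK` with `y⁻¹ δ ε(y) ∈ S`, of the right cosets `K · q.out⁻¹`** (the fibres of
`g ↦ g⁻¹K`, ★ `mem_preimage_mul_out_iff`; untwisted twin ★ `R90.S6.setOf_conj_mem_eq_biUnion_shell`). [cite: Laumon1995, Lemma (5.3.2) p. 136]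
[cite: Kottwitz1986BaseChangeUnits, §1 p. 240] -/
theorem setOf_mul_mul_apply_inv_mem_eq_biUnion_shell :
    {g : G | g * δ * (ε g)⁻¹ ∈ S} = ⋃ q ∈ {q : G ⧸ K | q.out⁻¹ * δ * ε q.out ∈ S}, (fun h : G => h * q.out) ⁻¹' (K : Set G) := by
  ext g
  simp only [Set.mem_setOf_eq, Set.mem_iUnion, exists_prop]
  constructor
  · intro hg
    refine ⟨((g⁻¹ : G) : G ⧸ K), ?_, (mem_preimage_mul_out_iff K _ g).2 rfl⟩
    rw [← inv_mul_mul_apply_mem_iff_out ε δ K hSK g⁻¹, inv_inv, map_inv]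
    exact hg
  · rintro ⟨q, hq, hgq⟩
    rw [mem_preimage_mul_out_iff K q g] at hgq
    rw [← hgq, ← inv_mul_mul_apply_mem_iff_out ε δ K hSK g⁻¹, inv_inv, map_inv] at hq
    exact hq

variable [TopologicalSpace G] [IsTopologicalGroup G] [MeasurableSpace G] [BorelSpace G]
  (ν : Measure G) [ν.IsMulRightInvariant]

/-- **`ν{g : g δ ε(g)⁻¹ ∈ S} = ν(K) · #{q ∈ G ⧸ K : q.out⁻¹ δ ε(q.out) ∈ S}`** for an OPEN subgroup `K` of non-zero measure, a right-invariant `ν` and a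
twisted-`K`-invariant `S` — in `[0, ∞]` with `Set.encard` (both sides `∞` together): each fibre `K · q.out⁻¹` has measure `ν(K)`, the fibres are disjoint and
exhaust the set ((J1)'s road verbatim; untwisted twin ★ `R90.S6.measure_setOf_conj_mem_eq_mul_encard_shell`). [cite: Laumon1995, Lemma (5.3.2) p. 136]
[cite: Kottwitz1986BaseChangeUnits, §1 p. 240] -/
theorem measure_setOf_mul_mul_apply_inv_mem_eq_mul_encard_shell (hK : IsOpen (K : Set G)) (hK0 : ν K ≠ 0) :
    ν {g : G | g * δ * (ε g)⁻¹ ∈ S} = ν K * (({q : G ⧸ K | q.out⁻¹ * δ * ε q.out ∈ S}.encard : ℕ∞) : ℝ≥0∞) := by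
  have hA : ∀ q : G ⧸ K, ν ((fun h : G => h * q.out) ⁻¹' (K : Set G)) = ν K := fun q =>
    measure_preimage_mul_right ν q.out _
  have hAm : ∀ q : G ⧸ K, MeasurableSet ((fun h : G => h * q.out) ⁻¹' (K : Set G)) := fun q =>
    (hK.preimage (continuous_mul_const _)).measurableSet
  have hsum : ∀ s : Finset (G ⧸ K),
      ν (⋃ q ∈ s, (fun h : G => h * q.out) ⁻¹' (K : Set G)) = (s.card : ℝ≥0∞) * ν K := by
    intro s
    rw [measure_biUnion_finset (pairwiseDisjoint_preimage_mul_out K (s : Set (G ⧸ K))) fun q _ => hAm q,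
      Finset.sum_congr rfl fun q _ => hA q, Finset.sum_const, nsmul_eq_mul]
  rw [setOf_mul_mul_apply_inv_mem_eq_biUnion_shell ε δ K hSK]
  rcases ({q : G ⧸ K | q.out⁻¹ * δ * ε q.out ∈ S}).finite_or_infinite with hfin | hinf
  · have hU : (⋃ q ∈ {q : G ⧸ K | q.out⁻¹ * δ * ε q.out ∈ S}, (fun h : G => h * q.out) ⁻¹' (K : Set G)) =
        ⋃ q ∈ hfin.toFinset, (fun h : G => h * q.out) ⁻¹' (K : Set G) := by
      rw [← Finset.set_biUnion_coe, hfin.coe_toFinset]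
    rw [hU, hsum, hfin.encard_eq_coe_toFinset_card, ENat.toENNReal_coe, mul_comm]
  · rw [hinf.encard_eq, ENat.toENNReal_top, ENNReal.mul_top hK0]
    have hle : ∀ n : ℕ, (n : ℝ≥0∞) * ν K ≤
        ν (⋃ q ∈ {q : G ⧸ K | q.out⁻¹ * δ * ε q.out ∈ S}, (fun h : G => h * q.out) ⁻¹' (K : Set G)) := by
      intro n
      obtain ⟨s, hs, hcard⟩ := hinf.exists_subset_card_eq n
      rw [← hcard, ← hsum s, ← Finset.set_biUnion_coe]
      exact measure_mono (Set.biUnion_subset_biUnion_left hs)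
    by_contra htop
    obtain ⟨n, hn⟩ := ENNReal.exists_nat_mul_gt hK0 htop
    exact absurd (hle n) (not_le.2 hn)

end Shell

/-! ## §2 The `[0, ∞]`-valued twisted orbital integral of `1_S` at a COMPACT ε-centraliser -/

section Quotient

variable {G : Type*} [Group G] [TopologicalSpace G] [IsTopologicalGroup G] [LocallyCompactSpace G]
  [SecondCountableTopology G] [T2Space G] [MeasurableSpace G] [BorelSpace G]
  (ε : G →* G) (δ : G) (K : Subgroup G)
  [MeasurableSpace (G ⧸ epsCentralizer ε δ)] [BorelSpace (G ⧸ epsCentralizer ε δ)]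
  [hC : IsClosed ((epsCentralizer ε δ : Subgroup G) : Set G)]
  (t : Measure (epsCentralizer ε δ)) [t.IsMulLeftInvariant]
  [IsFiniteMeasureOnCompacts t] [t.IsOpenPosMeasure] [t.IsInvInvariant] [SFinite t]
  (ν : Measure G) [IsHaarMeasure ν] [ν.IsMulRightInvariant]
  [CompactSpace (epsCentralizer ε δ)]
  (hε : Continuous ε) {S : Set G} (hS : IsOpen S) (hSK : ∀ k : G, k ∈ K → ∀ g : G, k * g * (ε k)⁻¹ ∈ S ↔ g ∈ S)

omit [TopologicalSpace G] [IsTopologicalGroup G] [LocallyCompactSpace G] [SecondCountableTopology G] [T2Space G] [MeasurableSpace G]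
  [BorelSpace G] [MeasurableSpace (G ⧸ epsCentralizer ε δ)] [BorelSpace (G ⧸ epsCentralizer ε δ)] hC [CompactSpace (epsCentralizer ε δ)] in
/-- **The descended twisted integrand on a coset**: `descEpsConj ε δ G_{δε} φ (g G_{δε}) = φ(g δ ε(g)⁻¹)` (the representative `out (g G_{δε}) = g m`,
`m ∈ G_{δε}`, fixes `δ` under twisted conjugation; private restatement at `M = G_{δε}` of the S4 lemma ★ `R90.S4.descEpsConj_mk`, kept local
so that this generic file imports no CM carrier). [cite: Rogawski1990, §1.6 p. 5] -/
private theorem descEpsConj_epsCentralizer_mk {α : Type*} (φ : G → α) (g : G) :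
    descEpsConj ε δ (epsCentralizer ε δ) φ (QuotientGroup.mk g : G ⧸ epsCentralizer ε δ) = φ (g * δ * (ε g)⁻¹) := by
  obtain ⟨m, hm⟩ := QuotientGroup.mk_out_eq_mul (epsCentralizer ε δ) g
  have hmδ : (m : G) * δ * (ε (m : G))⁻¹ = δ := (mem_epsCentralizer_iff ε δ _).1 m.2
  unfold descEpsConj
  rw [hm, map_mul]
  congr 1
  calc g * (m : G) * δ * (ε g * ε (m : G))⁻¹ = g * ((m : G) * δ * (ε (m : G))⁻¹) * (ε g)⁻¹ := by group
    _ = g * δ * (ε g)⁻¹ := by rw [hmδ]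

omit [LocallyCompactSpace G] [SecondCountableTopology G] [T2Space G] hC [CompactSpace (epsCentralizer ε δ)] in
include hε in
/-- **The descended twisted integrand of a Borel `φ` is Borel** for a CONTINUOUS `ε`: it is `φ` composed with the continuous map `y G_{δε} ↦ y δ ε(y)⁻¹`
(continuity on the quotient through `QuotientGroup.isOpenQuotientMap_mk`; untwisted twin ★ `Literature.MeasureTheory.Group.measurable_descConj`). [folklore] -/
theorem measurable_descEpsConj {α : Type*} [MeasurableSpace α] {φ : G → α} (hφ : Measurable φ) :
    Measurable (descEpsConj ε δ (epsCentralizer ε δ) φ) := by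
  have hcomp : descEpsConj ε δ (epsCentralizer ε δ) (id : G → G) ∘ (QuotientGroup.mk : G → G ⧸ epsCentralizer ε δ) =
      fun g => g * δ * (ε g)⁻¹ :=
    funext fun g => descEpsConj_epsCentralizer_mk ε δ id g
  have hcont : Continuous (descEpsConj ε δ (epsCentralizer ε δ) (id : G → G)) := by
    rw [← QuotientGroup.isOpenQuotientMap_mk.continuous_comp_iff, hcomp]
    exact (continuous_id.mul continuous_const).mul (hε.comp continuous_id).inv
  have heq : descEpsConj ε δ (epsCentralizer ε δ) φ = φ ∘ descEpsConj ε δ (epsCentralizer ε δ) (id : G → G) := rfl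
  rw [heq]
  exact hφ.comp hcont.measurable

include hε hS in
/-- **`∫⁻_{G ⧸ G_{δε}} 1_S(y δ ε(y)⁻¹) d(ν∕t) = t(G_{δε})⁻¹ · ν{g : g δ ε(g)⁻¹ ∈ S}`** for a COMPACT ε-centraliser and `S` open: the quotient measure by a compact
subgroup is `t(G_{δε})⁻¹ · π_* ν` (★ `lintegral_quotientMeasure_eq_inv_mul`) and the twisted integrand of `1_S` lifts to `1_{{g δ ε(g)⁻¹ ∈ S}}`.
[cite: Rogawski1990, §1.6 p. 5; §4.10 (4.10.1) p. 57] [cite: Kottwitz1986BaseChangeUnits, §1 p. 240] -/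
theorem lintegral_descEpsConj_indicator_quotientMeasure_eq_inv_mul_measure_shell :
    ∫⁻ y, descEpsConj ε δ (epsCentralizer ε δ) (S.indicator (1 : G → ℝ≥0∞)) y
          ∂quotientMeasure (epsCentralizer ε δ) t hC ν =
      (t Set.univ)⁻¹ * ν {g : G | g * δ * (ε g)⁻¹ ∈ S} := by
  have hSm : MeasurableSet {g : G | g * δ * (ε g)⁻¹ ∈ S} :=
    (hS.preimage ((continuous_id.mul continuous_const).mul (hε.comp continuous_id).inv)).measurableSet
  rw [lintegral_quotientMeasure_eq_inv_mul (epsCentralizer ε δ) t ν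
      (measurable_descEpsConj ε δ hε (measurable_one.indicator hS.measurableSet)),
    ← lintegral_indicator_one hSm]
  congr 1
  refine lintegral_congr fun g => ?_
  rw [descEpsConj_epsCentralizer_mk]
  -- the lifted integrand `g ↦ 1_S(g δ ε(g)⁻¹)` IS `1_{{g | g δ ε(g)⁻¹ ∈ S}}` (definitionally)
  rfl

include hε hS hSK in
/-- **`∫⁻_{G ⧸ G_{δε}} 1_S(y δ ε(y)⁻¹) d(ν∕t) = t(G_{δε})⁻¹ · ν(K) · #{q ∈ G ⧸ K : q.out⁻¹ δ ε(q.out) ∈ S}`** (compact ε-centraliser, `K` open, `S` open and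
twisted-`K`-invariant; `[0, ∞]`-valued, no finiteness hypothesis). [cite: Rogawski1990, §4.10 (4.10.1) p. 57] [cite: Laumon1995, Lemma (5.3.2) p. 136] -/
theorem lintegral_descEpsConj_indicator_quotientMeasure_eq_inv_mul_mul_encard_shell (hK : IsOpen (K : Set G)) :
    ∫⁻ y, descEpsConj ε δ (epsCentralizer ε δ) (S.indicator (1 : G → ℝ≥0∞)) y
          ∂quotientMeasure (epsCentralizer ε δ) t hC ν =
      (t Set.univ)⁻¹ * (ν K * (({q : G ⧸ K | q.out⁻¹ * δ * ε q.out ∈ S}.encard : ℕ∞) : ℝ≥0∞)) := by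
  rw [lintegral_descEpsConj_indicator_quotientMeasure_eq_inv_mul_measure_shell ε δ t ν hε hS,
    measure_setOf_mul_mul_apply_inv_mem_eq_mul_encard_shell ε δ K hSK ν hK (hK.measure_ne_zero ν ⟨1, K.one_mem⟩)]

include hε hS hSK in
/-- **THE TWISTED SHELL COUNT, `[0, ∞]` form: `∫⁻_{G ⧸ G_{δε}} 1_S(y δ ε(y)⁻¹) d(ν∕t) = ν(K) · #{q ∈ G ⧸ K : q.out⁻¹ δ ε(q.out) ∈ S}`** at the canonical
normalisation `t(G_{δε}) = 1` of the compact ε-centraliser (`Set.encard`, no finiteness hypothesis).  Print: «`TO_δ(f) = ∫_{G_{δσ}\G(L)} f(g⁻¹ δ σ(g)) dg`»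
at `f = 1_S`. [cite: Kottwitz1986BaseChangeUnits, §1 pp. 239–240] [cite: Rogawski1990, §4.10 (4.10.1) p. 57] [cite: Laumon1995, Lemma (5.3.2) p. 136] -/
theorem lintegral_descEpsConj_indicator_quotientMeasure_eq_mul_encard_shell (hK : IsOpen (K : Set G)) (ht : t Set.univ = 1) :
    ∫⁻ y, descEpsConj ε δ (epsCentralizer ε δ) (S.indicator (1 : G → ℝ≥0∞)) y
          ∂quotientMeasure (epsCentralizer ε δ) t hC ν =
      ν K * (({q : G ⧸ K | q.out⁻¹ * δ * ε q.out ∈ S}.encard : ℕ∞) : ℝ≥0∞) := by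
  rw [lintegral_descEpsConj_indicator_quotientMeasure_eq_inv_mul_mul_encard_shell ε δ K t ν hε hS hSK hK, ht, inv_one, one_mul]

/-! ## §3 The real twisted orbital integral `Φ_ε(δ, 1_S; ν∕t)` as `ν(K)` times a natural number -/

include hε hS in
omit [IsFiniteMeasureOnCompacts t] [t.IsOpenPosMeasure] [t.IsInvInvariant] [SFinite t] [t.IsMulLeftInvariant]
  [LocallyCompactSpace G] [SecondCountableTopology G] [T2Space G] hC [IsHaarMeasure ν] [ν.IsMulRightInvariant]
  [CompactSpace (epsCentralizer ε δ)] in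
/-- The real twisted orbital integral of `1_S` is the real part of the `[0, ∞]`-valued one: `Φ_ε(δ, 1_S; m) = (∫⁻ 1_S(y δ ε(y)⁻¹) dm).toReal` (non-negative
indicator integrand; ★ `epsOrbitalIntegral` unfolded; untwisted twin ★ `R90.S6.orbitalIntegral_indicator_eq_toReal_lintegral_shell`).
[cite: Rogawski1990, §1.6 p. 5; §4.10 (4.10.1) p. 57] -/
private theorem epsOrbitalIntegral_indicator_eq_toReal_lintegral_shell (m : Measure (G ⧸ epsCentralizer ε δ)) :
    epsOrbitalIntegral ε δ (S.indicator (1 : G → ℝ)) m =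
      (∫⁻ x, descEpsConj ε δ (epsCentralizer ε δ) (S.indicator (1 : G → ℝ≥0∞)) x ∂m).toReal := by
  unfold epsOrbitalIntegral
  rw [integral_eq_lintegral_of_nonneg_ae]
  · congr 1
    refine lintegral_congr fun x => ?_
    induction x using QuotientGroup.induction_on with
    | H g =>
      rw [descEpsConj_epsCentralizer_mk, descEpsConj_epsCentralizer_mk]
      by_cases hg : g * δ * (ε g)⁻¹ ∈ S
      · rw [Set.indicator_of_mem hg, Set.indicator_of_mem hg, Pi.one_apply, Pi.one_apply, ENNReal.ofReal_one]
      · rw [Set.indicator_of_notMem hg, Set.indicator_of_notMem hg, ENNReal.ofReal_zero]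
  · refine Eventually.of_forall fun x => ?_
    induction x using QuotientGroup.induction_on with
    | H g =>
      rw [Pi.zero_apply, descEpsConj_epsCentralizer_mk]
      exact Set.indicator_nonneg (fun _ _ => zero_le_one) _
  · exact (measurable_descEpsConj ε δ hε (measurable_one.indicator hS.measurableSet)).aestronglyMeasurable

include hε hS hSK in
/-- **`Φ_ε(δ, 1_S; ν∕t) = ν(K) · #{q ∈ G ⧸ K : q.out⁻¹ δ ε(q.out) ∈ S}`** (real twisted orbital integral ★ `epsOrbitalIntegral`; compact ε-centraliser of
`t`-mass one, `K` open, `S` open and twisted-`K`-invariant, `ε` continuous, finitely many such cosets).  For `S = K₀ t^λ K₀` in `G̃_v = GL₃(L_w)` and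
`ε` the quasi-split involution this is Kottwitz's `TO_δ(φ_λ)` as `ν(K₀)` times a count of twisted-fixed cosets.
[cite: Kottwitz1986BaseChangeUnits, §1 pp. 239–240, §3] [cite: Rogawski1990, §4.10 (4.10.1) p. 57] [cite: Laumon1995, Lemma (5.3.2) p. 136] -/
theorem epsOrbitalIntegral_indicator_quotientMeasure_eq_mul_ncard_shell (hK : IsOpen (K : Set G)) (ht : t Set.univ = 1)
    (hfin : {q : G ⧸ K | q.out⁻¹ * δ * ε q.out ∈ S}.Finite) :
    epsOrbitalIntegral ε δ (S.indicator (1 : G → ℝ)) (quotientMeasure (epsCentralizer ε δ) t hC ν) =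
      (ν K).toReal * ({q : G ⧸ K | q.out⁻¹ * δ * ε q.out ∈ S}.ncard : ℝ) := by
  rw [epsOrbitalIntegral_indicator_eq_toReal_lintegral_shell ε δ hε hS,
    lintegral_descEpsConj_indicator_quotientMeasure_eq_mul_encard_shell ε δ K t ν hε hS hSK hK ht, ENNReal.toReal_mul,
    hfin.encard_eq_coe_toFinset_card, ENat.toENNReal_coe, ENNReal.toReal_natCast, Set.ncard_eq_toFinset_card _ hfin]

include hε hS hSK in
/-- **`Φ_ε(δ, 1_S; ν∕t) = #{q ∈ G ⧸ K : q.out⁻¹ δ ε(q.out) ∈ S}`** at the unit normalisations `ν(K) = 1`, `t(G_{δε}) = 1` — «the number of cosets `yK` with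
`y⁻¹ δ ε(y) ∈ S`». [cite: Kottwitz1986BaseChangeUnits, §1 pp. 239–240] [cite: Rogawski1990, §4.10 (4.10.1) p. 57] -/
theorem epsOrbitalIntegral_indicator_quotientMeasure_eq_natCard_shell (hK : IsOpen (K : Set G)) (ht : t Set.univ = 1) (hν : ν K = 1)
    (hfin : {q : G ⧸ K | q.out⁻¹ * δ * ε q.out ∈ S}.Finite) :
    epsOrbitalIntegral ε δ (S.indicator (1 : G → ℝ)) (quotientMeasure (epsCentralizer ε δ) t hC ν) =
      (Nat.card {q : G ⧸ K | q.out⁻¹ * δ * ε q.out ∈ S} : ℝ) := by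
  rw [epsOrbitalIntegral_indicator_quotientMeasure_eq_mul_ncard_shell ε δ K t ν hε hS hSK hK ht hfin, hν, ENNReal.toReal_one, one_mul,
    Nat.card_coe_set_eq]

end Quotient

end Summit.HodgeConjecture.HodgeConjecture.R90.S6

end
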